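import Literature.Probability.RandomPlanarGeometry.SLESixHullLocalityNbhdAE
import Literature.Probability.RandomPlanarGeometry.SLEThrHorizonProofs
import Literature.Probability.RandomPlanarGeometry.LoewnerThrTipIdentity
import Literature.Probability.RandomPlanarGeometry.LoewnerThrRateIntegrable
import Literature.Probability.RandomPlanarGeometry.SLEThrImageBM
import Literature.Probability.RandomPlanarGeometry.SLESixLocalityOfHullNbhd
import HarnessLib

/-!
# Locality of chordal SLE₆ with respect to a bounded hull, neighbourhood form: PROVED (modulo gluing)

Topic `Probability/RandomPlanarGeometry` (crux `stmt-CriticalPhenomena-0698`, stub `stub_isLocal`).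
The final assembly of `sle_six_hull_locality_nbhd` from the landed pieces of the through-swallow
programme: the a.s. assembly `sle_six_hull_locality_nbhd_of_thr_ae`, the tip identity
`Loewner.thr_apply_clockC_eq_of_isGeneratedByCurve`, the horizon `thrHorizon` with its properties
(`SLEThrHorizonProofs.lean`), the DDS packaging `exists_thr_image_brownian_of_hasMartingaleClock`,
and — the one remaining input, taken as a hypothesis here — the stochastic GLUING: the martingale clock
structure of the through-swallow image driver stopped at the horizon (stub `stub_thrGluing`), with its
adaptedness / continuity by-products.
-/

noncomputable section

open Set Filter Topology Function Complex Metric MeasureTheory ProbabilityTheory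
open scoped NNReal ENNReal

namespace Literature.Probability.RandomPlanarGeometry

open Literature.Probability.Process Loewner

/-- **The gluing input** of the neighbourhood locality (stub `stub_thrGluing` + by-products): for the
through-swallow horizon `H = thrHorizon 6 A δ N`, the process
`Y t = (√6)⁻¹ · (thrImageDriver W A · stopped at H) t` with clock `c t = thrClock W A (t ∧ H)` is a
martingale clock pair for the Brownian filtration, `Y` is strongly adapted with continuous paths and `c`
is adapted. [cite: LawlerSchrammWerner2001, Thm. 2.2] -/
def ThrGluing : Prop :=
  ∀ {A : Set ℂ} (_ : IsStarHull A) (_ : A.Nonempty) {δ : ℝ} (_ : 0 < δ) (N : ℕ),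
    (∃ C : ℝ, HasMartingaleClock
      (fun t ω ↦ (Real.sqrt 6)⁻¹ * stoppedProcess
        (fun t ω ↦ thrImageDriver (drvK 6 (brownianCPath ω)) A t) (thrHorizon 6 A δ N) t ω)
      (fun t ω ↦ thrClock (drvK 6 (brownianCPath ω)) A
        (min (t : ℝ) (((thrHorizon 6 A δ N ω).untopD 0 : ℝ≥0) : ℝ)))
      brownianFiltration preWienerMeasure C) ∧
    StronglyAdapted brownianFiltration (fun t ω ↦ (Real.sqrt 6)⁻¹ * stoppedProcess
        (fun t ω ↦ thrImageDriver (drvK 6 (brownianCPath ω)) A t) (thrHorizon 6 A δ N) t ω) ∧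
    (∀ ω, Continuous fun t ↦ (Real.sqrt 6)⁻¹ * stoppedProcess
        (fun t ω ↦ thrImageDriver (drvK 6 (brownianCPath ω)) A t) (thrHorizon 6 A δ N) t ω) ∧
    Adapted brownianFiltration (fun t ω ↦ thrClock (drvK 6 (brownianCPath ω)) A
        (min (t : ℝ) (((thrHorizon 6 A δ N ω).untopD 0 : ℝ≥0) : ℝ)))

/-- **Locality of chordal SLE₆ with respect to a bounded hull, neighbourhood form, from the gluing
input alone** (everything else of the through-swallow programme being landed).
[cite: LawlerSchrammWerner2001, Thm 2.2] -/
theorem sle_six_hull_locality_nbhd_of_thrGluing (hglue : ThrGluing) : sle_six_hull_locality_nbhd := by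
  refine sle_six_hull_locality_nbhd_of_thr_ae
    (fun hW hW0 hA hne _ _ hβ hcl _ _ hγ hno _ hU' hag _ hγ' ↦
      thr_apply_clockC_eq_of_isGeneratedByCurve hW hW0 hA hne hβ hcl hγ hno hU' hag hγ') ?_
  intro A hA hne δ hδ
  have h68 : (6 : ℝ≥0) ≠ 8 := by norm_num
  refine ⟨thrHorizon 6 A δ, isStoppingTime_thrHorizon hA hne hδ, thrHorizon_ne_top, ?_, ?_, ?_, ?_⟩
  · -- closedness up to and including the horizon (a.s.) and finiteness of the values
    filter_upwards [ae_isClosed_remHull_of_coe_le_thrHorizon hA hne hδ h68] with ω hω N T₀ hT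
    exact ⟨fun t ht ↦ hω N t (by rw [hT]; exact WithTop.coe_le_coe.2 ht),
      finite_image_remHull_of_thrHorizon_eq hA hne hδ hT⟩
  · -- trace avoidance up to the horizon
    exact Eventually.of_forall fun ω N t ht ↦ sleTrace_notMem_of_coe_le_thrHorizon hA hne hδ ht
  · -- exhaustion of the `S₁`-hitting time
    exact Eventually.of_forall fun ω S₁ hS₁ hlt ↦ eventually_coe_lt_thrHorizon hA hne hδ ω hS₁ hlt
  · -- the through-swallow image Brownian motion at level `N`
    intro N
    obtain ⟨⟨C, hclock⟩, hYad, hYc, hcad⟩ := hglue hA hne hδ N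
    refine exists_thr_image_brownian_of_hasMartingaleClock hA (isStoppingTime_thrHorizon hA hne hδ N)
      (thrHorizon_le_succ N) hclock hYad hYc hcad fun ω ↦ ?_
    -- integrability of the rate up to the horizon, from strict closedness and finiteness (all paths)
    have hWc : Continuous (drvK 6 (brownianCPath ω)) := continuous_drvK 6 _
    obtain ⟨T₀, hT₀⟩ := WithTop.ne_top_iff_exists.1 (thrHorizon_ne_top (κ := 6) (A := A) (δ := δ) N ω)
    have hunt : (thrHorizon 6 A δ N ω).untopD 0 = T₀ := by rw [← hT₀, WithTop.untopD_coe]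
    rw [hunt]
    exact integrableOn_thrClockRate_of_lt hWc hA
      (fun t ht ↦ isClosed_remHull_of_coe_lt_thrHorizon hA hne hδ (by rw [← hT₀]; exact WithTop.coe_lt_coe.2 ht))
      (finite_image_remHull_of_thrHorizon_eq hA hne hδ hT₀.symm)

/-- **A family of chordal SLE₆ laws is LOCAL, given the gluing input** (`ChordalFamily.IsLocal`; the
restriction form of the locality of SLE₆, [LSW 2001] Cor. 2.4, assembled from the whole line).
[cite: LawlerSchrammWerner2001, Cor 2.4] -/
theorem ChordalFamily.isLocal_of_isSLELaw_six_of_thrGluing (hglue : ThrGluing) {Q : ChordalFamily}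
    (hQ : ∀ D : DobrushinDomain, IsSLELaw 6 D (Q D)) : Q.IsLocal :=
  ChordalFamily.isLocal_of_isSLELaw_six_of_hull_nbhd (sle_six_hull_locality_nbhd_of_thrGluing hglue) hQ

end Literature.Probability.RandomPlanarGeometry

end
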